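import Summits.QuantumFields.BalabanUV.InfraRed.StrongCouplingWeightedFrozenCovariance
import Summits.QuantumFields.BalabanUV.InfraRed.StrongCouplingForestHolonomyGauge
import HarnessLib

/-!
# Strong-coupling front, gen-14 engine (W3b): frozen-forest clustering and the SC-b door with WEIGHTED forest rows —
observatory of the non-perturbative crossover; no mass-gap claim

IR-3 v2 TWO-FRONT CROSSOVER LEDGER, front SC (`β₀`), `SU(N)` / `SU(2)`, `d = 4`.
ABSOLUTE RULE of this package: No internally-minted statement may enter as a cited fact. Every hypothesis is either
kernel-proved in this package or a verbatim quotation of a PUBLISHED theorem with page reference. The manuscript(s)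
under audit are NOT citable for their own disputed steps — they are the thing under adjudication; programme-internal
(2001/route/tribunal) claims are never citable.  Nothing is cited as a hypothesis here.

## What this file is

* `frozenForestClusteringW` — verbatim the tree's `StrongCouplingFrozenForestClustering.frozenForestClustering` (rung F3)
  with `WeightedForestRowBound (Fs S) (vs S) ρ`, uniform weight bounds `vmin ≤ vs S ≤ vmax` and the Dobrushin constant
  `ρ (|β|/N) K ≤ c < 1`; the clustering constant picks up the factor `vmax/vmin`, the RATE `krRate c` is unchanged;
* `exponentialClustering_of_frozenW` — verbatim `StrongCouplingForestDoorAssembly.exponentialClustering_of_frozen` with the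
  PROVED forest gauge fixing `forestGaugeFixing_specialUnitaryGroup N` (F2) and `frozenForestClusteringW` (F3-weighted);
* `su2_weightedForestDoor` — the SC-b door: ranked forests with weighted row constant `ρ` on all large odd tori,
  `OneLinkKRModulusSU2 β₀W K₂` and `ρ β₀W K₂ < 1` give `StrongCouplingFront (fundamentalLatticeRep 2) (β₀W/2)`.
With unit weights and `ρ = D` these are the tree's theorems; the weight table of the staggered forests is (W4).

NOT CLAIMED: any number of the ledger; no mass-gap claim.
-/

noncomputable section

open MeasureTheory ProbabilityTheory Filter Function Finset
open Literature.Probability.LatticeModels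
open Literature.Probability.LatticeModels.DobrushinMetric
open Literature.MathematicalPhysics.QuantumFieldTheory
open Literature.MathematicalPhysics.QuantumLattice (fundamentalRep fundamentalRep_apply fundamentalLatticeRep
  toTorusObservable LGConfig torusEdge torusLift)
open Literature.MathematicalPhysics.QuantumFieldTheory.Balaban1983to89
open Literature.MathematicalPhysics.QuantumFieldTheory.Balaban1983to89.StrongCouplingDobrushinWindow
open Literature.MathematicalPhysics.QuantumFieldTheory.Balaban1983to89.StrongCouplingTorusWindow
open Summit.QuantumFields.BalabanUV.InfraRed.StrongCouplingForestGauge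
open Summit.QuantumFields.BalabanUV.InfraRed.StrongCouplingForestGaugeFixing
open Summit.QuantumFields.BalabanUV.InfraRed.StrongCouplingFrozenForestSpec
open Summit.QuantumFields.BalabanUV.InfraRed.StrongCouplingFrozenForestKR
open Summit.QuantumFields.BalabanUV.InfraRed.StrongCouplingFrozenForestClustering
open Summit.QuantumFields.BalabanUV.InfraRed.StrongCouplingForestDoorAssembly
open Summit.QuantumFields.BalabanUV.InfraRed.StrongCouplingForestHolonomyGauge (forestGaugeFixing_specialUnitaryGroup)
open Summit.QuantumFields.BalabanUV.InfraRed.StrongCouplingWeightedFrozenCovariance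

namespace Summit.QuantumFields.BalabanUV.InfraRed.StrongCouplingWeightedForestDoor

set_option maxHeartbeats 400000 in
/-- **Frozen-forest clustering with WEIGHTED rows** (`SU(N)`, `d = 4`; twin of `frozenForestClustering`): with
`WeightedForestRowBound (Fs S) (vs S) ρ`, `vmin ≤ vs S y ≤ vmax`, `0 < vmin`, `0 ≤ ρ` for `S ≥ S₀`, the one-link
modulus and `ρ (|β|/N) K ≤ c < 1`, ONE constant bounds the connected correlation of bounded measurable local `F₁`,
`F₂ ∘ θ_x` under the frozen Wilson measure by `C e^{−krRate c ‖x‖_∞}` on every torus `(ℤ/(2S+1))⁴`, `S ≥ S₀`, `S ≥ 1`,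
`2‖x‖_∞ < 2S+1`. [cite: Follmer1988, Ch. I Theorem (2.13)] [cite: Georgii2011, Thm. 8.7, Thm. 8.20, Remark 8.26, §8.2]
[cite: Creutz2022, Ch. 9, eq. (9.19), p. 44] -/
theorem frozenForestClusteringW {N : ℕ} {ρ vmin vmax : ℝ} (hN : 1 ≤ N) (hρ0 : 0 ≤ ρ) (hvmin : 0 < vmin)
    (Fs : (S : ℕ) → Finset (Edge 4 (2 * S + 1))) (vs : (S : ℕ) → Edge 4 (2 * S + 1) → ℝ) (S₀ : ℕ)
    (hFs : ∀ S, S₀ ≤ S → WeightedForestRowBound (Fs S) (vs S) ρ ∧ (∀ y, vmin ≤ vs S y) ∧ ∀ y, vs S y ≤ vmax)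
    {β R K c : ℝ} (hK : 0 ≤ K) (hR : |β| / N * 6 ≤ R) (hmod : OneLinkKRModulus N R K)
    (hc : ρ * (|β| / N) * K ≤ c) (hc1 : c < 1)
    (F₁ F₂ : LGConfig 4 (Matrix.specialUnitaryGroup (Fin N) ℂ) → ℝ) (h₁ : Literature.MathematicalPhysics.QuantumLattice.IsLocalObservable F₁)
    (h₂ : Literature.MathematicalPhysics.QuantumLattice.IsLocalObservable F₂) (h₁m : Measurable F₁) (h₂m : Measurable F₂) (hb₁ : ∃ C, ∀ U, |F₁ U| ≤ C)
    (hb₂ : ∃ C, ∀ U, |F₂ U| ≤ C) :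
    ∃ C : ℝ, ∀ S : ℕ, S₀ ≤ S → 1 ≤ S → ∀ x : Literature.Probability.LatticeModels.Site 4,
      2 * ‖x‖ < ((2 * S + 1 : ℕ) : ℝ) →
      |(∫ V, toTorusObservable (2 * S + 1) (fun U => F₁ U * F₂ (Literature.MathematicalPhysics.QuantumLattice.configShift x U)) V
            ∂(frozenWilsonMeasure (d := 4) (L := 2 * S + 1) (fundamentalRep (Fin N)) (Fs S) β)) -
          (∫ V, toTorusObservable (2 * S + 1) F₁ V
              ∂(frozenWilsonMeasure (d := 4) (L := 2 * S + 1) (fundamentalRep (Fin N)) (Fs S) β)) *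
            ∫ V, toTorusObservable (2 * S + 1) (F₂ ∘ Literature.MathematicalPhysics.QuantumLattice.configShift x) V
              ∂(frozenWilsonMeasure (d := 4) (L := 2 * S + 1) (fundamentalRep (Fin N)) (Fs S) β)| ≤
        C * Real.exp (-(krRate c * ‖x‖)) := by
  classical
  obtain ⟨Λ₁, hΛ₁⟩ := h₁
  obtain ⟨Λ₂, hΛ₂⟩ := h₂
  obtain ⟨M₁, hM₁⟩ := hb₁
  obtain ⟨M₂, hM₂⟩ := hb₂
  set c' : ℝ := max c (1 / 2) with hc'def
  have hc'0 : 0 < c' := lt_max_of_lt_right (by norm_num)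
  have hc'1 : c' < 1 := max_lt hc1 (by norm_num)
  have hcc' : c ≤ c' := le_max_left _ _
  have hlogc : Real.log c' < 0 := Real.log_neg hc'0 hc'1
  have hM₁0 : 0 ≤ M₁ := (abs_nonneg _).trans (hM₁ fun _ => 1)
  have hM₂0 : 0 ≤ M₂ := (abs_nonneg _).trans (hM₂ fun _ => 1)
  have hN0 : (0 : ℝ) < N := by exact_mod_cast (show 0 < N by omega)
  have hE0 : 0 ≤ wilsonSmoothLip N 4 β := wilsonSmoothLip_nonneg hN 4 β
  have hR' : |β| / N * (2 * (((4 : ℕ) : ℝ) - 1)) ≤ R := by norm_num; linarith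
  -- the weight ratio
  set Vr : ℝ := vmax / vmin with hVrdef
  set D : ℕ := (Λ₁ ×ˢ Λ₂).sup fun ab => Literature.Probability.LatticeModels.Site.supNorm (ab.1.1 - ab.2.1)
    with hDdef
  set K' : ℝ := Real.exp (-(((D + 2 : ℕ) : ℝ) * Real.log c')) with hK'def
  have hK'0 : 0 < K' := Real.exp_pos _
  set J : ℝ := ((1 + 4 * (2 * (4 - 1)) : ℕ) : ℝ) with hJdef
  have hJ0 : 0 ≤ J := by rw [hJdef]; exact Nat.cast_nonneg _
  set E : ℝ := wilsonSmoothLip N 4 β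
  refine ⟨2 * M₁ * M₂ * K' + 2 * (2 * Real.sqrt N) ^ 2 * ((Λ₂.card * J) * (M₂ * E)) *
    ((Λ₁.card * J) * (|Vr| * K' * (M₁ * E))), fun S hS₀ hS1 x hx => ?_⟩
  obtain ⟨hFv, hvlo, hvhi⟩ := hFs S hS₀
  set L : ℕ := 2 * S + 1 with hLdef
  have hL1 : 1 < L := by omega
  set μ := frozenWilsonMeasure (d := 4) (L := L) (fundamentalRep (Fin N)) (Fs S) β with hμdef
  haveI : IsProbabilityMeasure μ :=
    (isGibbsMeasure_frozenWilsonMeasure (d := 4) (L := L) (Fs S) β).isProbabilityMeasure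
  set f : GaugeConfig 4 L (Matrix.specialUnitaryGroup (Fin N) ℂ) → ℝ := toTorusObservable L F₁
  set g : GaugeConfig 4 L (Matrix.specialUnitaryGroup (Fin N) ℂ) → ℝ := toTorusObservable L (F₂ ∘ Literature.MathematicalPhysics.QuantumLattice.configShift x)
  have hfm : Measurable f := h₁m.comp (measurable_torusLift L)
  have hgm : Measurable g := (h₂m.comp (Literature.MathematicalPhysics.QuantumLattice.configShift x).measurable).comp (measurable_torusLift L)
  have hfdep := dependsOn_toTorusObservable (G := Matrix.specialUnitaryGroup (Fin N) ℂ) L hΛ₁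
  have hgdep := dependsOn_toTorusObservable_configShift (G := Matrix.specialUnitaryGroup (Fin N) ℂ) L hΛ₂ x
  have hMf : ∀ σ, |f σ| ≤ M₁ := fun σ => hM₁ _
  have hMg : ∀ σ, |g σ| ≤ M₂ := fun σ => hM₂ _
  rw [show (∫ V, toTorusObservable L (fun U => F₁ U * F₂ (Literature.MathematicalPhysics.QuantumLattice.configShift x U)) V ∂μ) = ∫ V, f V * g V ∂μ from rfl]
  set Δf : Finset (Edge 4 L) := Λ₁.image (torusEdge L)
  set Δg : Finset (Edge 4 L) := Λ₂.image fun e => torusEdge L (e.1 - x, e.2) with hΔg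
  have hfdep' : DependsOn f (↑Δf : Set (Edge 4 L)) := hfdep
  have hgdep' : DependsOn g (↑Δg : Set (Edge 4 L)) := hgdep
  have hxL : 2 * Literature.Probability.LatticeModels.Site.supNorm x < L := by
    rw [Literature.Probability.LatticeModels.Site.norm_eq_supNorm] at hx
    exact_mod_cast hx
  have hexp : Real.exp (-(krRate c * ‖x‖)) =
      Real.exp ((Literature.Probability.LatticeModels.Site.supNorm x : ℝ) * Real.log c') := by
    rw [Literature.Probability.LatticeModels.Site.norm_eq_supNorm, krRate, ← hc'def]
    congr 1
    ring
  rw [hexp]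
  have htriv : |(∫ V, f V * g V ∂μ) - (∫ V, f V ∂μ) * ∫ V, g V ∂μ| ≤ 2 * M₁ * M₂ := by
    calc |(∫ V, f V * g V ∂μ) - (∫ V, f V ∂μ) * ∫ V, g V ∂μ|
        ≤ |∫ V, f V * g V ∂μ| + |(∫ V, f V ∂μ) * ∫ V, g V ∂μ| := abs_sub _ _
      _ ≤ M₁ * M₂ + M₁ * M₂ := by
          refine add_le_add (abs_integral_le_of_abs_le (abs_mul_le_of_abs_le hMf hMg)) ?_
          rw [abs_mul]
          exact mul_le_mul (abs_integral_le_of_abs_le hMf) (abs_integral_le_of_abs_le hMg) (abs_nonneg _) hM₁0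
      _ = 2 * M₁ * M₂ := by ring
  by_cases hnear : Literature.Probability.LatticeModels.Site.supNorm x < D + 2
  · have hone : 1 ≤ K' * Real.exp ((Literature.Probability.LatticeModels.Site.supNorm x : ℝ) * Real.log c') := by
      rw [hK'def, ← Real.exp_add]
      refine Real.one_le_exp ?_
      have : ((Literature.Probability.LatticeModels.Site.supNorm x : ℕ) : ℝ) ≤ ((D + 2 : ℕ) : ℝ) := by
        exact_mod_cast hnear.le
      nlinarith
    refine htriv.trans ?_
    calc 2 * M₁ * M₂ ≤ 2 * M₁ * M₂ * (K' * Real.exp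
          ((Literature.Probability.LatticeModels.Site.supNorm x : ℝ) * Real.log c')) :=
          le_mul_of_one_le_right (by positivity) hone
      _ ≤ (2 * M₁ * M₂ * K' + 2 * (2 * Real.sqrt N) ^ 2 * ((Λ₂.card * J) * (M₂ * E)) *
            ((Λ₁.card * J) * (|Vr| * K' * (M₁ * E)))) *
            Real.exp ((Literature.Probability.LatticeModels.Site.supNorm x : ℝ) * Real.log c') := by
          rw [add_mul]
          refine le_add_of_le_of_nonneg (le_of_eq (by ring)) (by positivity)
  rw [not_lt] at hnear
  have hsep : ∀ y ∈ plaqClosure Δf, y ∉ Δg := by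
    intro y hy hyg
    obtain ⟨y₀, hy₀, hyy₀⟩ := exists_near_of_mem_plaqClosure hy
    obtain ⟨a, ha, rfl⟩ := Finset.mem_image.1 hy₀
    obtain ⟨b, hb, rfl⟩ := Finset.mem_image.1 hyg
    have hs := supNorm_le_torusNorm_add (L := L) (a := a.1) (b := b.1) hxL
    have hDab : Literature.Probability.LatticeModels.Site.supNorm (a.1 - b.1) ≤ D := by
      rw [hDdef]
      exact Finset.le_sup (f := fun ab : ZdEdge 4 × ZdEdge 4 =>
        Literature.Probability.LatticeModels.Site.supNorm (ab.1.1 - ab.2.1)) (Finset.mk_mem_product ha hb)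
    have h1 : torusNorm ((torusEdge L a).1 - (torusEdge L (b.1 - x, b.2)).1) ≤ 1 := by
      rw [← torusNorm_neg, neg_sub]; exact hyy₀
    have h2 : Literature.Probability.LatticeModels.Site.supNorm x ≤ 1 + D := hs.trans (Nat.add_le_add h1 hDab)
    omega
  by_cases hΛ₂e : Λ₂ = ∅
  · have hΔg0 : Δg = ∅ := by rw [hΔg, hΛ₂e, Finset.image_empty]
    set V₁ : GaugeConfig 4 L (Matrix.specialUnitaryGroup (Fin N) ℂ) := fun _ => 1
    have hgc : ∀ V, g V = g V₁ := fun V => hgdep' fun i hi => by simp [hΔg0] at hi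
    have hI1 : ∫ V, f V * g V ∂μ = (∫ V, f V ∂μ) * g V₁ := by
      rw [← integral_mul_const]
      exact integral_congr_ae (ae_of_all _ fun V => by simp only [hgc V])
    have hI2 : ∫ V, g V ∂μ = g V₁ := by
      have h := integral_congr_ae (μ := μ) (ae_of_all μ fun V => hgc V)
      rw [integral_const, smul_eq_mul, probReal_univ, one_mul] at h
      exact h
    have hI : (∫ V, f V * g V ∂μ) - (∫ V, f V ∂μ) * ∫ V, g V ∂μ = 0 := by rw [hI1, hI2, sub_self]
    rw [hI, abs_zero]
    positivity
  have hΔgne : (plaqClosure Δg).Nonempty :=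
    ((Finset.nonempty_iff_ne_empty.2 hΛ₂e).image _).mono (subset_plaqClosure Δg)
  obtain ⟨ℓ, hℓ0, hℓ1, hℓ2⟩ := exists_linkProfile (plaqClosure Δg) hΔgne
  have hc'' : ρ * (|β| / N) * K ≤ c' := hc.trans hcc'
  have key := abs_integral_mul_sub_le_frozenWilson_weighted (d := 4) (by norm_num) hN hL1 (Fs S) hFv hρ0 hvmin hvlo
    hK hR' hmod hc'' hc'1.le hfm hfdep' hMf hgm hgdep' hMg hsep ℓ hℓ0 (fun x' _ y hy => hℓ1 x' y hy)
  refine key.trans ?_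
  have hVr : ∀ y : Edge 4 L, vs S y / vmin ≤ |Vr| := fun y =>
    (div_le_div_of_nonneg_right (hvhi y) hvmin.le).trans (by rw [hVrdef]; exact le_abs_self _)
  have hpow : ∀ y ∈ plaqClosure Δf, c' ^ ℓ y ≤
      K' * Real.exp ((Literature.Probability.LatticeModels.Site.supNorm x : ℝ) * Real.log c') := by
    intro y hy
    obtain ⟨y₀, hy₀, hyy₀⟩ := exists_near_of_mem_plaqClosure hy
    obtain ⟨a, ha, rfl⟩ := Finset.mem_image.1 hy₀
    obtain ⟨z, hz, hzle⟩ := hℓ2 y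
    obtain ⟨z₀, hz₀, hzz₀⟩ := exists_near_of_mem_plaqClosure hz
    obtain ⟨b, hb, rfl⟩ := Finset.mem_image.1 hz₀
    have hs := supNorm_le_torusNorm_add (L := L) (a := a.1) (b := b.1) hxL
    have hDab : Literature.Probability.LatticeModels.Site.supNorm (a.1 - b.1) ≤ D := by
      rw [hDdef]
      exact Finset.le_sup (f := fun ab : ZdEdge 4 × ZdEdge 4 =>
        Literature.Probability.LatticeModels.Site.supNorm (ab.1.1 - ab.2.1)) (Finset.mk_mem_product ha hb)
    have htri : torusNorm ((torusEdge L a).1 - (torusEdge L (b.1 - x, b.2)).1) ≤ 1 + ℓ y + 1 := by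
      calc torusNorm ((torusEdge L a).1 - (torusEdge L (b.1 - x, b.2)).1)
          ≤ torusNorm ((torusEdge L a).1 - y.1) + torusNorm (y.1 - (torusEdge L (b.1 - x, b.2)).1) :=
            torusNorm_sub_le _ _ _
        _ ≤ torusNorm ((torusEdge L a).1 - y.1) +
              (torusNorm (y.1 - z.1) + torusNorm (z.1 - (torusEdge L (b.1 - x, b.2)).1)) :=
            Nat.add_le_add_left (torusNorm_sub_le _ _ _) _
        _ ≤ 1 + (ℓ y + 1) := by
            refine Nat.add_le_add ?_ (Nat.add_le_add hzle hzz₀)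
            rw [← torusNorm_neg, neg_sub]; exact hyy₀
        _ = 1 + ℓ y + 1 := by ring
    have hineq : (Literature.Probability.LatticeModels.Site.supNorm x : ℝ) ≤ ℓ y + ((D + 2 : ℕ) : ℝ) := by
      have : Literature.Probability.LatticeModels.Site.supNorm x ≤ ℓ y + (D + 2) := by
        have := hs.trans (Nat.add_le_add htri hDab); omega
      exact_mod_cast this
    rw [hK'def, ← Real.exp_add, ← Real.exp_log hc'0, ← Real.exp_nat_mul, Real.exp_log hc'0]
    refine Real.exp_le_exp.2 ?_
    nlinarith
  have hsumf : ∑ y ∈ plaqClosure Δf, vs S y / vmin * c' ^ ℓ y * (M₁ * E) ≤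
      (Λ₁.card * J) * (|Vr| * K' * Real.exp ((Literature.Probability.LatticeModels.Site.supNorm x : ℝ) *
        Real.log c') * (M₁ * E)) := by
    calc ∑ y ∈ plaqClosure Δf, vs S y / vmin * c' ^ ℓ y * (M₁ * E)
        ≤ ∑ _y ∈ plaqClosure Δf, |Vr| * K' * Real.exp ((Literature.Probability.LatticeModels.Site.supNorm x : ℝ) *
            Real.log c') * (M₁ * E) := by
          refine Finset.sum_le_sum fun y hy => mul_le_mul_of_nonneg_right ?_ (by positivity)
          rw [mul_assoc]
          exact mul_le_mul (hVr y) (hpow y hy) (pow_nonneg hc'0.le _) (abs_nonneg _)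
      _ = (plaqClosure Δf).card * (|Vr| * K' * Real.exp ((Literature.Probability.LatticeModels.Site.supNorm x : ℝ) *
            Real.log c') * (M₁ * E)) := by rw [Finset.sum_const, nsmul_eq_mul]
      _ ≤ (Λ₁.card * J) * (|Vr| * K' * Real.exp ((Literature.Probability.LatticeModels.Site.supNorm x : ℝ) *
            Real.log c') * (M₁ * E)) := by
          refine mul_le_mul_of_nonneg_right ?_ (by positivity)
          have h1 : ((plaqClosure Δf).card : ℝ) ≤ Δf.card * J := by
            rw [hJdef]; exact_mod_cast card_plaqClosure_le Δf
          have h2 : (Δf.card : ℝ) ≤ Λ₁.card := by exact_mod_cast Finset.card_image_le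
          exact h1.trans (mul_le_mul_of_nonneg_right h2 hJ0)
  have hsumg : ∑ _y ∈ plaqClosure Δg, M₂ * E ≤ (Λ₂.card * J) * (M₂ * E) := by
    rw [Finset.sum_const, nsmul_eq_mul]
    refine mul_le_mul_of_nonneg_right ?_ (by positivity)
    have h1 : ((plaqClosure Δg).card : ℝ) ≤ Δg.card * J := by
      rw [hJdef]; exact_mod_cast card_plaqClosure_le Δg
    have h2 : (Δg.card : ℝ) ≤ Λ₂.card := by exact_mod_cast Finset.card_image_le
    exact h1.trans (mul_le_mul_of_nonneg_right h2 hJ0)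
  have hterm0 : ∀ y ∈ plaqClosure Δf, 0 ≤ vs S y / vmin * c' ^ ℓ y * (M₁ * E) := fun y _ =>
    mul_nonneg (mul_nonneg (div_nonneg (hvmin.le.trans (hvlo y)) hvmin.le) (pow_nonneg hc'0.le _)) (by positivity)
  calc 2 * (2 * Real.sqrt N) ^ 2 * (∑ _y ∈ plaqClosure Δg, M₂ * E) *
        ∑ y ∈ plaqClosure Δf, vs S y / vmin * c' ^ ℓ y * (M₁ * E)
      ≤ 2 * (2 * Real.sqrt N) ^ 2 * ((Λ₂.card * J) * (M₂ * E)) * ((Λ₁.card * J) * (|Vr| * K' * Real.exp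
          ((Literature.Probability.LatticeModels.Site.supNorm x : ℝ) * Real.log c') * (M₁ * E))) := by
        exact mul_le_mul (mul_le_mul_of_nonneg_left hsumg (by positivity)) hsumf
          (Finset.sum_nonneg hterm0) (by positivity)
    _ = 2 * (2 * Real.sqrt N) ^ 2 * ((Λ₂.card * J) * (M₂ * E)) * ((Λ₁.card * J) * (|Vr| * K' * (M₁ * E))) *
          Real.exp ((Literature.Probability.LatticeModels.Site.supNorm x : ℝ) * Real.log c') := by ring
    _ ≤ (2 * M₁ * M₂ * K' + 2 * (2 * Real.sqrt N) ^ 2 * ((Λ₂.card * J) * (M₂ * E)) *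
          ((Λ₁.card * J) * (|Vr| * K' * (M₁ * E)))) *
          Real.exp ((Literature.Probability.LatticeModels.Site.supNorm x : ℝ) * Real.log c') := by
        rw [add_mul]
        exact le_add_of_nonneg_left (by positivity)

/-- **Weighted F1 + F2 + F3 ⇒ exponential clustering of the Wilson torus states** (`SU(N)`, `d = 4`; twin of
`exponentialClustering_of_frozen` with the proved forest gauge fixing `forestGaugeFixing_specialUnitaryGroup N`): ranked
forests with weighted row constant `ρ`, the one-link modulus and `ρ (|β|/N) K ≤ c < 1` give
`ExponentialClustering (fundamentalRep (Fin N)) β (krRate c)`. [cite: Creutz2022, Ch. 9, eq. (9.19), p. 44]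
[cite: Follmer1988, Ch. I Theorem (2.13)] -/
theorem exponentialClustering_of_frozenW {N : ℕ} {ρ vmin vmax : ℝ} (hN : 1 ≤ N) (hρ0 : 0 ≤ ρ) (hvmin : 0 < vmin)
    (Fs : (S : ℕ) → Finset (Edge 4 (2 * S + 1))) (rks : (S : ℕ) → Site 4 (2 * S + 1) → ℕ)
    (vs : (S : ℕ) → Edge 4 (2 * S + 1) → ℝ) (S₀ : ℕ)
    (hforest : ∀ S, S₀ ≤ S → IsRankedForest (Fs S) (rks S) ∧ WeightedForestRowBound (Fs S) (vs S) ρ ∧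
      (∀ y, vmin ≤ vs S y) ∧ ∀ y, vs S y ≤ vmax)
    {β R K c : ℝ} (hK : 0 ≤ K) (hR : |β| / N * 6 ≤ R) (hmod : OneLinkKRModulus N R K)
    (hc : ρ * (|β| / N) * K ≤ c) (hc1 : c < 1) :
    CrossoverLedger.ExponentialClustering (G := Matrix.specialUnitaryGroup (Fin N) ℂ) (fundamentalRep (Fin N)) β
      (krRate c) := by
  have hF2 := forestGaugeFixing_specialUnitaryGroup N
  refine ⟨krRate_pos hc1, fun A B => ?_⟩
  obtain ⟨C, hC⟩ := frozenForestClusteringW hN hρ0 hvmin Fs vs S₀ (fun S hS => (hforest S hS).2) hK hR hmod hc hc1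
    A.F B.F ⟨A.supp, A.isCylinder⟩ ⟨B.supp, B.isCylinder⟩ A.measurable B.measurable A.bounded B.bounded
  refine ⟨C, max S₀ 1, fun S hS n hn => ?_⟩
  have hS₀ : S₀ ≤ S := le_of_max_le_left hS
  have hS1 : 1 ≤ S := le_of_max_le_right hS
  set x : Literature.Probability.LatticeModels.Site 4 := -Pi.single (0 : Fin 4) (n : ℤ) with hxdef
  have hxn : ‖x‖ = n := norm_neg_single_natCast n
  have hx2 : 2 * ‖x‖ < ((2 * S + 1 : ℕ) : ℝ) := by
    rw [hxn]; push_cast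
    have : (n : ℝ) ≤ S := by exact_mod_cast hn
    linarith
  have h := hC S hS₀ hS1 x hx2
  rw [hxn] at h
  set μ := wilsonMeasure (d := 4) (L := 2 * S + 1) (fundamentalRep (Fin N)) β with hμ
  have hcont : Continuous ⇑(fundamentalRep (Fin N)) := (fundamentalLatticeRep N).continuous
  haveI : IsProbabilityMeasure μ := isProbabilityMeasure_wilsonMeasure _ hcont β
  have hrk : IsRankedForest (Fs S) (rks S) := (hforest S hS₀).1
  have key : ∀ Φ : GaugeConfig 4 (2 * S + 1) (Matrix.specialUnitaryGroup (Fin N) ℂ) → ℝ,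
      IsGaugeInvariant Φ → Measurable Φ → (∃ M : ℝ, ∀ V, |Φ V| ≤ M) →
        ∫ V, Φ V ∂μ =
          ∫ V, Φ V ∂(frozenWilsonMeasure (d := 4) (L := 2 * S + 1) (fundamentalRep (Fin N)) (Fs S) β) := by
    intro Φ hΦ hΦm hM
    obtain ⟨M, hM⟩ := hM
    exact hF2 hcont 4 (2 * S + 1) (Fs S) (rks S) hrk β Φ hΦ
      (Integrable.of_bound hΦm.aestronglyMeasurable M (ae_of_all _ fun V => by
        rw [Real.norm_eq_abs]; exact hM V))
  obtain ⟨M₁, hM₁⟩ := A.bounded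
  obtain ⟨M₂, hM₂⟩ := B.bounded
  have hAi : IsGaugeInvariant (toTorusObservable (2 * S + 1) A.F) :=
    isGaugeInvariant_toTorusObservable A.gaugeInvariant _
  have hBxi : IsGaugeInvariant (toTorusObservable (2 * S + 1) (B.F ∘ Literature.MathematicalPhysics.QuantumLattice.configShift x)) :=
    isGaugeInvariant_toTorusObservable (isZdGaugeInvariant_comp_configShift_eq B.gaugeInvariant x) _
  have hABi : IsGaugeInvariant (toTorusObservable (2 * S + 1) (fun U => A.F U * B.F (Literature.MathematicalPhysics.QuantumLattice.configShift x U))) :=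
    isGaugeInvariant_toTorusObservable (isZdGaugeInvariant_mul_configShift A.gaugeInvariant B.gaugeInvariant x) _
  have hAm : Measurable (toTorusObservable (2 * S + 1) A.F) := A.measurable.comp (measurable_torusLift _)
  have hBxm : Measurable (toTorusObservable (2 * S + 1) (B.F ∘ Literature.MathematicalPhysics.QuantumLattice.configShift x)) :=
    (B.measurable.comp (Literature.MathematicalPhysics.QuantumLattice.configShift x).measurable).comp (measurable_torusLift _)
  have hABm : Measurable (toTorusObservable (2 * S + 1) (fun U => A.F U * B.F (Literature.MathematicalPhysics.QuantumLattice.configShift x U))) :=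
    (A.measurable.mul (B.measurable.comp (Literature.MathematicalPhysics.QuantumLattice.configShift x).measurable)).comp (measurable_torusLift _)
  have hMA : ∀ V, |toTorusObservable (2 * S + 1) A.F V| ≤ M₁ := fun V => hM₁ _
  have hMBx : ∀ V, |toTorusObservable (2 * S + 1) (B.F ∘ Literature.MathematicalPhysics.QuantumLattice.configShift x) V| ≤ M₂ := fun V => hM₂ _
  have hMAB : ∀ V, |toTorusObservable (2 * S + 1) (fun U => A.F U * B.F (Literature.MathematicalPhysics.QuantumLattice.configShift x U)) V| ≤ M₁ * M₂ :=
    fun V => abs_mul_le_of_abs_le hMA hMBx V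
  have e1 := key _ hABi hABm ⟨M₁ * M₂, hMAB⟩
  have e2 := key _ hAi hAm ⟨M₁, hMA⟩
  have e3 := key _ hBxi hBxm ⟨M₂, hMBx⟩
  have htrans : ∫ V, toTorusObservable (2 * S + 1) (B.F ∘ Literature.MathematicalPhysics.QuantumLattice.configShift x) V ∂μ =
      ∫ V, toTorusObservable (2 * S + 1) B.F V ∂μ := by
    rw [toTorusObservable_comp_configShift]
    simp only [Function.comp_apply]
    rw [← integral_map_equiv, hμ, wilsonMeasure_map_torusConfigShift]
  rw [← e1, ← e2, ← e3, htrans] at h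
  exact h

/-- **The WEIGHTED forest door** (`SU(2)`, Wilson units; twin of `forestDobrushinDoor_of_gaugeFixing_of_frozenClustering`):
ranked forests on all large odd tori with weighted row constant `ρ` (weights between `vmin > 0` and `vmax`),
`OneLinkKRModulusSU2 β₀W K₂` and `ρ β₀W K₂ < 1` put the strong-coupling front at `β₀W` (tree coupling `β₀W/2`), with the
single rate `krRate (ρ β₀W K₂)` for all `0 ≤ β ≤ β₀W/2`. [cite: Creutz2022, Ch. 9, eq. (9.19), p. 44]
[cite: Follmer1988, Ch. I Theorem (2.13)] -/
theorem su2_weightedForestDoor {ρ vmin vmax β₀W K₂ : ℝ} (hρ0 : 0 ≤ ρ) (hvmin : 0 < vmin) (hK₂ : 0 ≤ K₂)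
    (Fs : (S : ℕ) → Finset (Edge 4 (2 * S + 1))) (rks : (S : ℕ) → Site 4 (2 * S + 1) → ℕ)
    (vs : (S : ℕ) → Edge 4 (2 * S + 1) → ℝ) (S₀ : ℕ)
    (hforest : ∀ S, S₀ ≤ S → IsRankedForest (Fs S) (rks S) ∧ WeightedForestRowBound (Fs S) (vs S) ρ ∧
      (∀ y, vmin ≤ vs S y) ∧ ∀ y, vs S y ≤ vmax)
    (hmod : OneLinkKRModulusSU2 β₀W K₂) (hsmall : ρ * β₀W * K₂ < 1) :
    CrossoverLedger.StrongCouplingFront (fundamentalLatticeRep 2) (β₀W / 2) := by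
  refine ⟨krRate (ρ * β₀W * K₂), krRate_pos hsmall, fun β hβ0 hββ₀ => ?_⟩
  have hβabs : |β| = β := abs_of_nonneg hβ0
  refine exponentialClustering_of_frozenW (N := 2) (by norm_num) hρ0 hvmin Fs rks vs S₀ hforest (K := 4 * K₂)
    (by positivity) (R := 3 * β₀W / 2) ?_ hmod ?_ hsmall
  · rw [hβabs]; push_cast; linarith
  · rw [hβabs]; push_cast
    have key : 0 ≤ ρ * K₂ * (β₀W - 2 * β) := mul_nonneg (mul_nonneg hρ0 hK₂) (by linarith)
    nlinarith [key]

end Summit.QuantumFields.BalabanUV.InfraRed.StrongCouplingWeightedForestDoor
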